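import Literature.Computability.AlgebraicComplexity.GlobalStageCompatCount
import Literature.Computability.AlgebraicComplexity.CompatiblePrime
import Literature.Computability.AlgebraicComplexity.InterfaceBlockCounts
import Literature.Computability.AlgebraicComplexity.InterfaceSlotSymmetry
import HarnessLib

/-!
# The number of compatible level-1 `Z`-blocks is a product over the classes of Def. 5.15
(Vassilevska Williams–Xu–Xu–Zhou 2024, Claim 5.14, proof: "count … for each of these subsets of
indices, and multiply them together") — proved

Topic `Literature/Computability/AlgebraicComplexity`.  Claim 5.14 of Vassilevska Williams–Xu–Xu–Zhou
(SODA 2024, arXiv:2307.07970) computes `p_comp` from the count of the level-1 blocks `Z_K̂ ∈ Z_K`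
compatible with a fixed `α`-consistent triple `X_I Y_J Z_K`: "In Def. 5.15, there are constraints on
the complete split distributions of `K̂` on some disjoint subsets of `[A₁n]`.  Therefore, we can
count the number of valid subsequences of `K̂` for each of these subsets of indices, and multiply
them together … `2^{H(γ_{Z,i,j,k}) · α(i,j,k) · A₁ n ± o(n)}` … `2^{H(γ̄_{Z,+,+,k}) · α(+,+,k) · A₁ n ± o(n)}`
… `= 2^{(H(α) + λ_Z) · A₁ n ± o(n)}`."  This file PROVES the exact form:

* `coarseTermMap` — the COARSE class map of a block triple: a position `t` goes to its class
  `S_{i,j,k}` if `I_t = 0` or `J_t = 0`, and to `S_{+,+,k}` otherwise (Def. 5.15's disjoint subsets),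
  with parameter list `coarseTermList` (`(k, γ_{Z,i,j,k})`, resp. `(k, γ̄_{Z,+,+,k})`);
* `compatCount_eq_card_levelBlocks_coarse` — **the compatible `K̂ ∈ Z_K` are exactly the admissible
  sequences of this coarse one-level interface datum**, so `C = |levelBlocksX coarse 0|` and the
  landed product/entropy theorems of `InterfaceBlockCounts.lean` apply verbatim
  (`compatCount_eq_prod_multinomial`, `compatCount_le_two_rpow`, `two_rpow_le_mul_compatCount`:
  `C = ∏_classes binom`, `2^{∑ |S| H} / poly ≤ C ≤ 2^{∑ |S| H}` with `∑ |S| H = λ_Z · n` for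
  `α`-consistent triples, `card_coarseFibre_*`);
* `levelBlocksZ_eq_levelBlocksX_swapXZ` — the `Z`-block counts (`M_Z = usefulZCount`) are `X`-block
  counts of the renamed data, so the same three theorems give `M_Z = ∏ binom(α(i,j,k)n; γ_{Z,i,j,k})`.

Everything is proved; the definitions are the coarse class data; no named facts.

## References

* V. Vassilevska Williams, Y. Xu, Z. Xu, R. Zhou, *New bounds for matrix multiplication: from alpha
  to omega*, SODA 2024, arXiv:2307.07970 (held: `paper:arxiv-2307.07970`), Claim 5.14 (proof) and
  Def. 5.15. [VassilevskaWilliamsXuXuZhou2024]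
-/

noncomputable section

open scoped BigOperators
open Finset

namespace Literature.Computability.AlgebraicComplexity

/-! ## `Z`-blocks are `X`-blocks of the renamed data -/

section SwapZ

variable {c n s : ℕ}

/-- `levelBlocksZ τ L ε = levelBlocksX τ (L.swapXZ) ε` (definitional). [folklore] -/
theorem levelBlocksZ_eq_levelBlocksX_swapXZ (τ : Fin n → Fin s) (L : Fin s → InterfaceTerm c) (ε : ℝ) :
    levelBlocksZ τ L ε = levelBlocksX τ (fun t => (L t).swapXZ) ε := rfl

/-- `levelBlocksY τ L ε = levelBlocksX τ (L.swapXY) ε` (definitional). [folklore] -/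
theorem levelBlocksY_eq_levelBlocksX_swapXY (τ : Fin n → Fin s) (L : Fin s → InterfaceTerm c) (ε : ℝ) :
    levelBlocksY τ L ε = levelBlocksX τ (fun t => (L t).swapXY) ε := rfl

end SwapZ

/-! ## The coarse classes of Def. 5.15 -/

section Coarse

variable (c : ℕ) {n : ℕ}

/-- The coarse classes: `(some (i,j), k)` for the boundary constituent classes (`i = 0` or `j = 0`)
and `(none, k)`, `k ≤ 2c`, for `S_{+,+,k}`. [cite: VassilevskaWilliamsXuXuZhou2024, Def. 5.15] -/
def coarseClasses : Finset (Option (ℕ × ℕ) × ℕ) :=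
  ((constituentTriples c).filter fun ijk => ijk.1 = 0 ∨ ijk.2.1 = 0).image
      (fun ijk => (some (ijk.1, ijk.2.1), ijk.2.2)) ∪
    (range (2 * c + 1)).image fun k => (none, k)

/-- Boundary classes belong to the coarse classes. [folklore] -/
theorem some_mem_coarseClasses {i j k : ℕ} (h : i + j + k = 2 * c) (hb : i = 0 ∨ j = 0) :
    (some (i, j), k) ∈ coarseClasses c := by
  refine mem_union_left _ (mem_image.2 ⟨(i, j, k), mem_filter.2 ⟨(mem_constituentTriples c).2 h, hb⟩, rfl⟩)

/-- The classes `S_{+,+,k}` belong to the coarse classes. [folklore] -/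
theorem none_mem_coarseClasses {k : ℕ} (hk : k ≤ 2 * c) : (none, k) ∈ coarseClasses c :=
  mem_union_right _ (mem_image.2 ⟨k, mem_range.2 (Nat.lt_succ_of_le hk), rfl⟩)

variable {c}

/-- The coarse class of a position of a block triple. [cite: VassilevskaWilliamsXuXuZhou2024, Def. 5.15] -/
def coarseClassOf (I J K : Fin n → ℕ) (t : Fin n) : Option (ℕ × ℕ) × ℕ :=
  if I t = 0 ∨ J t = 0 then (some (I t, J t), K t) else (none, K t)

/-- The coarse class of a position is a coarse class. [folklore] -/
theorem coarseClassOf_mem {I J K : Fin n → ℕ} (h : IsLevelTriple c I J K) (t : Fin n) :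
    coarseClassOf I J K t ∈ coarseClasses c := by
  unfold coarseClassOf
  split_ifs with hb
  · exact some_mem_coarseClasses c (h t) hb
  · refine none_mem_coarseClasses c ?_
    have := h t; omega

/-- **The coarse term map** of a block triple (positions enumerated into `Fin |coarseClasses c|`).
[cite: VassilevskaWilliamsXuXuZhou2024, Def. 5.15] -/
def coarseTermMap {I J K : Fin n → ℕ} (h : IsLevelTriple c I J K) : Fin n → Fin (coarseClasses c).card :=
  fun t => (coarseClasses c).equivFin ⟨coarseClassOf I J K t, coarseClassOf_mem h t⟩

/-- The split distribution attached to a coarse class: `γ_{Z,i,j,k}` on a boundary class,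
`γ̄_{Z,+,+,k}` on `S_{+,+,k}`. [cite: VassilevskaWilliamsXuXuZhou2024, Def. 5.15] -/
def coarseGamma (c : ℕ) (α : ℕ × ℕ × ℕ → ℝ) (γZ : ℕ × ℕ × ℕ → (Fin c → Fin 3) → ℝ) :
    Option (ℕ × ℕ) × ℕ → (Fin c → Fin 3) → ℝ
  | (some (i, j), k) => γZ (i, j, k)
  | (none, k) => gammaBarZPP c α γZ k

/-- **The coarse parameter list**: the class with `Z`-level `k` and its split distribution, written
as the `X`-data of an interface term (so that the landed `X`-block counts apply). [cite: VassilevskaWilliamsXuXuZhou2024, Def. 5.15 and Claim 5.14 (proof)] -/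
def coarseTermList (c : ℕ) (α : ℕ × ℕ × ℕ → ℝ) (γZ : ℕ × ℕ × ℕ → (Fin c → Fin 3) → ℝ) :
    Fin (coarseClasses c).card → InterfaceTerm c := fun s =>
  let cl : Option (ℕ × ℕ) × ℕ := ((coarseClasses c).equivFin.symm s).1
  ⟨cl.2, 0, 0, coarseGamma c α γZ cl, coarseGamma c α γZ cl, coarseGamma c α γZ cl⟩

/-- The fibre of the coarse term map over a class. [cite: VassilevskaWilliamsXuXuZhou2024, Def. 5.15] -/
theorem filter_coarseTermMap_eq {I J K : Fin n → ℕ} (h : IsLevelTriple c I J K) (s : Fin (coarseClasses c).card) :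
    (univ.filter fun t => coarseTermMap h t = s) = univ.filter fun t => coarseClassOf I J K t = ((coarseClasses c).equivFin.symm s).1 := by
  ext t
  simp only [mem_filter, mem_univ, true_and, coarseTermMap]
  rw [Equiv.apply_eq_iff_eq_symm_apply]
  constructor
  · intro ht; exact congrArg Subtype.val ht
  · intro ht; exact Subtype.ext ht

/-- The fibre over a boundary class `(i,j,k)` is the position class `S_{i,j,k}`. [cite: VassilevskaWilliamsXuXuZhou2024, Def. 5.15 (1)] -/
theorem filter_coarseClassOf_some {I J K : Fin n → ℕ} {i j k : ℕ} (hb : i = 0 ∨ j = 0) :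
    (univ.filter fun t => coarseClassOf I J K t = (some (i, j), k)) = posClass I J K i j k := by
  ext t
  simp only [mem_filter, mem_univ, true_and, mem_posClass, coarseClassOf]
  split_ifs with ht
  · simp only [Prod.mk.injEq, Option.some.injEq]
    tauto
  · simp only [Prod.mk.injEq, reduceCtorEq, false_and, false_iff, not_and]
    intro h1 h2 _
    exact ht (by rcases hb with hb | hb <;> [left; right] <;> omega)

/-- The fibre over `(none, k)` is `S_{+,+,k}`. [cite: VassilevskaWilliamsXuXuZhou2024, Def. 5.15 (2)] -/
theorem filter_coarseClassOf_none {I J K : Fin n → ℕ} {k : ℕ} :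
    (univ.filter fun t => coarseClassOf I J K t = (none, k)) = posClassPP I J K k := by
  ext t
  simp only [mem_filter, mem_univ, true_and, mem_posClassPP, coarseClassOf]
  split_ifs with ht
  · simp only [Prod.mk.injEq, reduceCtorEq, false_and, false_iff, not_and]
    intro _ h1 h2
    rcases ht with ht | ht <;> [exact h1 ht; exact h2 ht]
  · simp only [Prod.mk.injEq, true_and]
    simp only [not_or] at ht
    tauto

/-- **The compatible level-1 `Z`-blocks in `Z_K` are the admissible sequences of the coarse datum.**
[cite: VassilevskaWilliamsXuXuZhou2024, Def. 5.15 and Claim 5.14 (proof)] -/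
theorem mem_levelBlocksX_coarse_iff {α : ℕ × ℕ × ℕ → ℝ} {γZ : ℕ × ℕ × ℕ → (Fin c → Fin 3) → ℝ}
    {I J K : Fin n → ℕ} (h : IsLevelTriple c I J K) (Kh : Fin n → Fin c → Fin 3) :
    Kh ∈ levelBlocksX (coarseTermMap h) (coarseTermList c α γZ) 0 ↔
      chunkLevels Kh = K ∧ IsCompatibleWith' c α γZ I J K Kh := by
  rw [levelBlocksX, mem_admissibleSeqs]
  refine and_congr ?_ ?_
  · -- levels: the `Z`-level of the class of `t` is `K t`
    simp only [funext_iff, chunkLevels_apply, coarseTermList, coarseTermMap, Equiv.symm_apply_apply]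
    refine forall_congr' fun t => ?_
    have : (coarseClassOf I J K t).2 = K t := by
      unfold coarseClassOf; split_ifs <;> rfl
    rw [this]
  · constructor
    · intro hc
      refine ⟨fun i j k hb hne => ?_, fun k hne => ?_⟩
      · have hmem : (some (i, j), k) ∈ coarseClasses c := by
          obtain ⟨t, ht⟩ := hne
          rw [mem_posClass] at ht
          refine some_mem_coarseClasses c ?_ hb
          rw [← ht.1, ← ht.2.1, ← ht.2.2]; exact h t
        have := hc ((coarseClasses c).equivFin ⟨_, hmem⟩)
        rw [filter_coarseTermMap_eq, Equiv.symm_apply_apply, filter_coarseClassOf_some hb] at this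
        have := this hne
        rw [splitConsistentOn_zero_iff] at this
        simpa [coarseTermList, coarseGamma] using this
      · have hmem : (none, k) ∈ coarseClasses c := by
          obtain ⟨t, ht⟩ := hne
          rw [mem_posClassPP] at ht
          refine none_mem_coarseClasses c ?_
          have := h t; omega
        have := hc ((coarseClasses c).equivFin ⟨_, hmem⟩)
        rw [filter_coarseTermMap_eq, Equiv.symm_apply_apply, filter_coarseClassOf_none] at this
        have := this hne
        rw [splitConsistentOn_zero_iff] at this
        simpa [coarseTermList, coarseGamma] using this
    · rintro ⟨h1, h2⟩ s hne
      rw [filter_coarseTermMap_eq] at hne ⊢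
      rw [splitConsistentOn_zero_iff]
      simp only [coarseTermList]
      -- the class of `s`
      generalize hcs : (coarseClasses c).equivFin.symm s = cs at hne ⊢
      obtain ⟨cl, hcl⟩ := cs
      rcases cl with ⟨_ | ⟨i, j⟩, k⟩
      · rw [filter_coarseClassOf_none] at hne ⊢
        simpa [coarseGamma] using h2 k hne
      · -- a boundary class: `i = 0 ∨ j = 0` from membership
        have hb : i = 0 ∨ j = 0 := by
          rcases mem_union.1 hcl with hcl | hcl
          · obtain ⟨ijk, hijk, he⟩ := mem_image.1 hcl
            simp only [Prod.mk.injEq, Option.some.injEq] at he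
            obtain ⟨⟨rfl, rfl⟩, -⟩ := he
            exact (mem_filter.1 hijk).2
          · obtain ⟨k', -, he⟩ := mem_image.1 hcl
            simp at he
        rw [filter_coarseClassOf_some hb] at hne ⊢
        simpa [coarseGamma] using h1 i j k hb hne

end Coarse

/-! ## `C` as a block count of the coarse datum, and its product form -/

namespace GlobalStageData

open scoped Classical

variable {c n M : ℕ} {D : GlobalStageData c n M}

/-- **`C(T) = |levelBlocksX (coarse datum of T) 0|`** for an `α`-consistent block triple `T`
(Def. 5.15 is equivalent to compatibility, `isCompatibleWith_iff_isCompatibleWith'`).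
[cite: VassilevskaWilliamsXuXuZhou2024, Claim 5.14 (proof) and Def. 5.15] -/
theorem compatCount_eq_card_levelBlocks_coarse (hD : D.WellFormed)
    {T : (Fin n → Fin (2 * c + 1)) × (Fin n → Fin (2 * c + 1)) × (Fin n → Fin (2 * c + 1))} (hT : T ∈ D.𝒯α) :
    D.compatCount T = (levelBlocksX (coarseTermMap (isLevelTriple_of_mem_tripleSet (hD.subset hT)))
      (coarseTermList c D.α D.γZ) 0).card := by
  have hlev := isLevelTriple_of_mem_tripleSet (hD.subset hT)
  have hα := hD.alphaConsistent T hT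
  unfold compatCount
  congr 1
  ext Kh
  rw [mem_filter, mem_levelBlocksX_coarse_iff, ← isCompatibleWith_iff_isCompatibleWith' hlev hα,
    chunkLevels_eq_iff]
  simp [Compatible]

/-- **`C = ∏_{classes} binom(|S|; k_S)`** for integral class types `k_S = |S| · γ_S` supported on
chunk shapes of the class level. [cite: VassilevskaWilliamsXuXuZhou2024, Claim 5.14 (proof: "multiply them together")] -/
theorem compatCount_eq_prod_multinomial (hD : D.WellFormed)
    {T : (Fin n → Fin (2 * c + 1)) × (Fin n → Fin (2 * c + 1)) × (Fin n → Fin (2 * c + 1))} (hT : T ∈ D.𝒯α)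
    (k : Fin (coarseClasses c).card → (Fin c → Fin 3) → ℕ)
    (hk : ∀ s σ, (k s σ : ℝ) = (termFibre (coarseTermMap (isLevelTriple_of_mem_tripleSet (hD.subset hT))) s).card *
      (coarseTermList c D.α D.γZ s).γX σ)
    (hsupp : ∀ s σ, k s σ ≠ 0 → patternLevel σ = (coarseTermList c D.α D.γZ s).i)
    (hsum : ∀ s, ∑ σ, k s σ = (termFibre (coarseTermMap (isLevelTriple_of_mem_tripleSet (hD.subset hT))) s).card) :
    D.compatCount T = ∏ s, Nat.multinomial univ (k s) := by
  rw [compatCount_eq_card_levelBlocks_coarse hD hT]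
  exact card_levelBlocksX_zero_eq_prod_multinomial _ _ k hk hsupp hsum

/-- **`C ≤ 2^{∑_S |S| H(k_S/|S|)}`** (Lemma 3.3, upper half). [cite: VassilevskaWilliamsXuXuZhou2024, Claim 5.14 (proof: "2^{H(γ) · |S| ± o(n)}")] -/
theorem compatCount_le_two_rpow (hD : D.WellFormed)
    {T : (Fin n → Fin (2 * c + 1)) × (Fin n → Fin (2 * c + 1)) × (Fin n → Fin (2 * c + 1))} (hT : T ∈ D.𝒯α)
    (k : Fin (coarseClasses c).card → (Fin c → Fin 3) → ℕ)
    (hk : ∀ s σ, (k s σ : ℝ) = (termFibre (coarseTermMap (isLevelTriple_of_mem_tripleSet (hD.subset hT))) s).card *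
      (coarseTermList c D.α D.γZ s).γX σ)
    (hsupp : ∀ s σ, k s σ ≠ 0 → patternLevel σ = (coarseTermList c D.α D.γZ s).i)
    (hsum : ∀ s, ∑ σ, k s σ = (termFibre (coarseTermMap (isLevelTriple_of_mem_tripleSet (hD.subset hT))) s).card) :
    (D.compatCount T : ℝ) ≤ 2 ^ (∑ s, ((termFibre (coarseTermMap (isLevelTriple_of_mem_tripleSet (hD.subset hT))) s).card : ℝ) *
      shannonEntropy (fun σ => (k s σ : ℝ) / (termFibre (coarseTermMap (isLevelTriple_of_mem_tripleSet (hD.subset hT))) s).card)) := by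
  rw [compatCount_eq_card_levelBlocks_coarse hD hT]
  exact card_levelBlocksX_zero_le_two_rpow _ _ k hk hsupp hsum

/-- **`2^{∑_S |S| H(k_S/|S|)} ≤ (∏_S (|S|+1)^{3^c}) · C`** (Lemma 3.3, lower half; the polynomial loss is
`2^{o(n)}`). [cite: VassilevskaWilliamsXuXuZhou2024, Claim 5.14 (proof)] -/
theorem two_rpow_le_mul_compatCount (hD : D.WellFormed)
    {T : (Fin n → Fin (2 * c + 1)) × (Fin n → Fin (2 * c + 1)) × (Fin n → Fin (2 * c + 1))} (hT : T ∈ D.𝒯α)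
    (k : Fin (coarseClasses c).card → (Fin c → Fin 3) → ℕ)
    (hk : ∀ s σ, (k s σ : ℝ) = (termFibre (coarseTermMap (isLevelTriple_of_mem_tripleSet (hD.subset hT))) s).card *
      (coarseTermList c D.α D.γZ s).γX σ)
    (hsupp : ∀ s σ, k s σ ≠ 0 → patternLevel σ = (coarseTermList c D.α D.γZ s).i)
    (hsum : ∀ s, ∑ σ, k s σ = (termFibre (coarseTermMap (isLevelTriple_of_mem_tripleSet (hD.subset hT))) s).card) :
    (2 : ℝ) ^ (∑ s, ((termFibre (coarseTermMap (isLevelTriple_of_mem_tripleSet (hD.subset hT))) s).card : ℝ) *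
      shannonEntropy (fun σ => (k s σ : ℝ) / (termFibre (coarseTermMap (isLevelTriple_of_mem_tripleSet (hD.subset hT))) s).card)) ≤
      (∏ s, (((termFibre (coarseTermMap (isLevelTriple_of_mem_tripleSet (hD.subset hT))) s).card + 1 : ℝ)) ^ (3 ^ c)) *
        D.compatCount T := by
  rw [compatCount_eq_card_levelBlocks_coarse hD hT]
  exact two_rpow_le_mul_card_levelBlocksX_zero _ _ k hk hsupp hsum

/-- **The class sizes**: `|S_{i,j,k}| = α(i,j,k) n` on a boundary class and `|S_{+,+,k}| = α(+,+,k) n`,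
so that `∑_S |S| H(γ_S) = n · λ_Z` (the printed exponent). [cite: VassilevskaWilliamsXuXuZhou2024, §5 (preamble: λ_Z) and Claim 5.14 (proof)] -/
theorem card_termFibre_coarse (hD : D.WellFormed)
    {T : (Fin n → Fin (2 * c + 1)) × (Fin n → Fin (2 * c + 1)) × (Fin n → Fin (2 * c + 1))} (hT : T ∈ D.𝒯α)
    (s : Fin (coarseClasses c).card) :
    ((termFibre (coarseTermMap (isLevelTriple_of_mem_tripleSet (hD.subset hT))) s).card : ℝ) =
      (match ((coarseClasses c).equivFin.symm s).1 with
        | (some (i, j), k) => D.α (i, j, k)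
        | (none, k) => alphaPP c D.α k) * n := by
  have hlev := isLevelTriple_of_mem_tripleSet (hD.subset hT)
  have hα := hD.alphaConsistent T hT
  dsimp only [termFibre]
  rw [filter_coarseTermMap_eq]
  generalize hcs : (coarseClasses c).equivFin.symm s = cs
  obtain ⟨cl, hcl⟩ := cs
  rcases cl with ⟨_ | ⟨i, j⟩, k⟩
  · simp only
    rw [filter_coarseClassOf_none]
    exact card_posClassPP_eq hlev hα k
  · have hb : i = 0 ∨ j = 0 := by
      rcases mem_union.1 hcl with hcl | hcl
      · obtain ⟨ijk, hijk, he⟩ := mem_image.1 hcl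
        simp only [Prod.mk.injEq, Option.some.injEq] at he
        obtain ⟨⟨rfl, rfl⟩, -⟩ := he
        exact (mem_filter.1 hijk).2
      · obtain ⟨k', -, he⟩ := mem_image.1 hcl
        simp at he
    simp only
    rw [filter_coarseClassOf_some hb]
    exact hα i j k

/-- **`#{typical pairs} = binom(n; θ)`**, `θ` the joint type of any typical pair (the printed count
"the number of typical `Z_K̂` is `2^{H(γ̄_Z) · A₁ n ± o(n)}`" before taking entropies).
[cite: VassilevskaWilliamsXuXuZhou2024, Claim 5.14 (proof, quantity (2))] -/
theorem card_typicalPairs_eq_multinomial {p₀ : (Fin n → Fin (2 * c + 1)) × (Fin n → Fin c → Fin 3)}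
    (hp₀ : p₀ ∈ D.typicalPairs) :
    D.typicalPairs.card = Nat.multinomial univ (letterCount (pairSeq p₀.1 p₀.2)) := by
  rw [card_typicalPairs_eq hp₀, card_typeClass_eq_multinomial n _ (sum_letterCount _)]

/-- **`numalpha = binom(n; Q)`** when `𝒯α` is the set of all triples of joint type `Q`.
[cite: VassilevskaWilliamsXuXuZhou2024, §5.2 (numalpha) and Claim 5.4] -/
theorem card_alphaTriples_eq_multinomial {Q : Fin (2 * c + 1) × Fin (2 * c + 1) × Fin (2 * c + 1) → ℕ}
    (h : D.𝒯α = jointTypeClass n Q) (hQ : ∑ s, Q s = n) : D.𝒯α.card = Nat.multinomial univ Q := by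
  rw [h, card_jointTypeClass n Q hQ]

end GlobalStageData

end Literature.Computability.AlgebraicComplexity
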